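import Literature.Analysis.FluidPDE.AxisymNoSwirlQuotMaxPrinciple
import Literature.Analysis.FluidPDE.AxisymmetricVorticityTransport
import Literature.Analysis.FluidPDE.BiotSavartRepresentation
import Literature.Analysis.FluidPDE.LipschitzSqIntegrableDecay
import HarnessLib

/-!
# Scale-invariant a-priori bounds for axisymmetric Navier–Stokes flows without swirl
# (Gallay–Šverák 2015): the Biot–Savart bound `‖u‖_∞ ≤ C‖rω_θ‖_{L¹(Ω)}^{1/2}‖ω_θ/r‖_∞^{1/2}`,
# conservation of the impulse, `t‖ω_θ(t)‖_∞ ≤ C(‖ω₀‖_{L¹(Ω)})`, `√t‖u(t)‖_∞ ≤ C(‖ω₀‖_{L¹(Ω)})`,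
# and the resulting ALL-TIME SPEED CAP for single-signed finite-impulse flows

Analysis/FluidPDE literature file: four NAMED FACTS (D-0014, cite-tagged, unproved here) from

> Th. Gallay, V. Šverák, *Remarks on the Cauchy problem for the axisymmetric Navier–Stokes
> equations*, Confluentes Math. **7** (2015), no. 2, 67–92 = arXiv:1510.01036 (bib key
> `GallaySverak2016`; all page/equation numbers below are those of the arXiv version),

and their elementary PROVED consequences, in the vocabulary of the tree's smooth axisymmetric
calculus (`IsAxisymmetric`, `HasNoSwirl`, `cylRadius`, `angVortQuot u = ω_θ/r`, `curl`,
`biotSavart`) and of Tao's smooth finite-energy class `IsTaoSolutionOn T ν u₀ u p`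
(`TaoClassGlue`).

The paper studies the axisymmetric Navier–Stokes equations WITHOUT swirl, viscosity `1`
((1.1)–(1.2)), through the azimuthal vorticity `ω_θ` on the half-plane
`Ω = {(r, z) : r > 0}` equipped with the measure `dr dz` ((1.5), p. 3), `η = ω_θ/r` ((1.6)),
and the scale-invariant norm `‖ω_θ‖_{L¹(Ω)}`. Its Theorem 1.1 (p. 4): for `ω₀ ∈ L¹(Ω)` there is
a unique global mild solution, `‖ω_θ(t)‖_{L¹(Ω)} ≤ ‖ω₀‖_{L¹(Ω)}`, with the new scale-invariant
a-priori estimates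

* (1.11) `sup_{t>0} t‖ω_θ(t)‖_{L^∞(Ω)} ≤ C(‖ω₀‖_{L¹(Ω)})` (Prop. 5.3, p. 16–17), and
* (1.12) `sup_{t>0} √t ‖u(t)‖_{L^∞} ≤ C(‖ω₀‖_{L¹(Ω)})` ((5.12), p. 17),

`C(s) = O(s)` as `s → 0`, obtained from the axisymmetric Biot–Savart bounds of §2, notably

* Prop. 2.6 (2.14) (p. 8, after Feng–Šverák, ARMA 215 (2015)):
  `‖u‖_{L^∞(Ω)} ≤ C ‖rω_θ‖_{L¹(Ω)}^{1/2} ‖ω_θ/r‖_{L^∞(Ω)}^{1/2}`;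

and, for non-negative vorticity with finite impulse `𝓘 = ∫_Ω r²ω₀ dr dz` ((1.9)),

* Lemma 6.4 (p. 19): `∫_Ω r²ω_θ(t) dr dz = ∫_Ω r²ω₀ dr dz` for all `t ≥ 0`.

## What is typed here, and how

Dictionary (`dx = r dr dθ dz`; for axisymmetric swirl-free `u`, `ω = curl u = ω_θ e_θ`,
`‖ω‖ = |ω_θ|`, `angVortQuot u = η = ω_θ/r`, `swirl (curl u) = rω_θ = r²η`):
`‖ω_θ‖_{L¹(Ω)} = (2π)⁻¹ ∫_{ℝ³} |η| dx`, `‖rω_θ‖_{L¹(Ω)} = (2π)⁻¹ ∫_{ℝ³} ‖ω‖ dx`,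
`𝓘 = ‖r²ω_θ‖_{L¹(Ω)} = (2π)⁻¹ ∫_{ℝ³} r²η dx` (`ω_θ ≥ 0`), `‖ω_θ‖_{L^∞(Ω)} = sup ‖ω‖`,
`‖ω_θ/r‖_{L^∞(Ω)} = sup |η|`, `‖u‖_{L^∞(Ω)} = sup ‖u‖`.

* `GallaySverak2015.VelocitySupBound` — **Prop. 2.6 (2.14)**, a KINEMATIC statement about the
  Biot–Savart velocity `biotSavart ω` of a continuous integrable purely azimuthal axisymmetric
  vorticity field `ω = ω_θ(r,z) e_θ` on `ℝ³` (rendered: `IsAxisymmetric ω`, zero radial part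
  `x₀ω₀ + x₁ω₁ = 0`, zero axial part `ω₂ = 0`) with `‖ω(x)‖ ≤ M r(x)` (i.e. `‖ω_θ/r‖_∞ ≤ M`):
  `‖biotSavart ω (x)‖ ≤ C √((∫‖ω‖) · M)` — the printed right-hand side with `(2π)^{-1/2}`
  absorbed into `C`. (The paper's `u` is "the velocity field defined from `ω_θ` via the
  axisymmetric Biot–Savart law (2.8)", which is the three-dimensional Biot–Savart law (2.1)–(2.4)
  written for `ω = ω_θ e_θ`; the tree's `biotSavart` is Majda–Bertozzi's `K₃ * ω`,
  `Vorticity.lean`.) TODO(general form): (2.15) `‖u_r/r‖_∞ ≤ C‖ω_θ‖_{L¹(Ω)}^{1/3}‖ω_θ/r‖_∞^{2/3}`,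
  Prop. 2.3–2.4 and Remark 2.7 are not vendored.
* `GallaySverak2015.ImpulseConservation` — **Lemma 6.4**, `GallaySverak2015.VorticitySupBound` —
  **Prop. 5.3 with `p = ∞`** (= (1.11)), `GallaySverak2015.VelocitySupDecay` — **(1.12)/(5.12)**,
  stated for the tree's smooth class: a Tao-class solution `IsTaoSolutionOn T 1 u₀ u p` (`ν = 1`
  as in print, any `T > 0`) of the unforced system whose datum is axisymmetric without swirl
  (the solution then stays so, `IsTaoSolutionOn.isAxisymmetric`, `…hasNoSwirl`,
  `AxisymmetricNoSwirlGlobal`) with `η₀ = angVortQuot u₀ ∈ L¹(ℝ³)`, i.e. `ω₀ ∈ L¹(Ω)`. This is the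
  SPECIAL CASE of the printed statements for smooth finite-energy data: such a solution is smooth
  and bounded with bounded derivatives on `[0, T] × ℝ³`, its `ω_θ` solves (4.1) classically
  (Remark 4.6, p. 15) and is the paper's unique mild solution (Prop. 4.1 and the uniqueness
  argument p. 13–14: uniqueness holds among all mild solutions in
  `C⁰([0,T];L¹(Ω)) ∩ C⁰((0,T];L^∞(Ω))`). TODO(general form): data `ω₀ ∈ L¹(Ω)` of infinite
  energy, finite measures (Thm. 1.3), the mild formulation (4.2)/(4.11) with the semigroup (3.2),
  the decay (1.10), Prop. 6.2, Cor. 6.3 and the asymptotics (1.13)/Prop. 6.6 are not vendored.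
  "`C(s) = O(s)` as `s → 0`" is rendered `∃ K δ, 0 < δ ∧ ∀ s ∈ [0, δ], C s ≤ K s`.

PROVED here (elementary consequences; the second is the statement consumers asked for):

* `norm_curl_eq_cylRadius_mul_abs_angVortQuot` (`‖ω‖ = r|η|`), `integral_cylRadius_mul_le_sqrt`
  (`∫ r|η| ≤ (∫|η|)^{1/2}(∫r²|η|)^{1/2}`, i.e. `‖rω_θ‖_{L¹(Ω)}² ≤ ‖ω_θ‖_{L¹(Ω)}‖r²ω_θ‖_{L¹(Ω)}`),
  `IsTaoSolutionOn.biotSavart_curl_eq` (a Tao-class slice is the Biot–Savart velocity of its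
  vorticity once the vorticity is integrable: `biotSavart_curl_eq_self_holds`; the slice tends to
  `0` at infinity, being Lipschitz and square integrable, and has bounded vorticity);
* `speedCap_of_facts` — **the all-time speed cap.** Assuming the two
  facts `VelocitySupBound` and `ImpulseConservation`: for a Tao-class solution (`ν = 1`) from an
  axisymmetric swirl-free datum with `0 ≤ η₀ ≤ M`, `η₀ ∈ L¹`, `r²η₀ ∈ L¹`, and every
  `t ∈ [0, T]`, `x ∈ ℝ³`:
  `‖u(t, x)‖ ≤ C · ((∫η₀)(∫r²η₀))^{1/4} · M^{1/2}` with the constant `C` of Prop. 2.6 —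
  by (2.14) at time `t`, Cauchy–Schwarz, and the three monotone quantities
  `∫|η(t)| ≤ ∫|η₀|` (Lemma 5.1, tree theorem `IsTaoSolutionOn.lintegral_abs_angVortQuot_le`),
  `∫r²η(t) = ∫r²η₀` (Lemma 6.4), `0 ≤ η(t) ≤ M` (maximum principle for `ω_θ/r`, tree theorems
  `IsTaoSolutionOn.angVortQuot_nonneg_of_datum`, `…abs_angVortQuot_le_of_datum`). In the paper's
  units: `sup_x |u(t,x)| ≤ C ‖ω_θ(s)‖_{L¹(Ω)}^{1/4} 𝓘^{1/4} ‖(ω_θ/r)(s)‖_∞^{1/2}` for all `t ≥ s`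
  — a bound fixed by the data, uniform in time (not printed as such in the paper; an assembly of
  its Prop. 2.6, Lemma 5.1, Lemma 6.4 and the classical maximum principle).
* unpacked forms of the two dynamic facts (`…norm_curl_le_of_fact`, `…norm_le_div_sqrt_of_fact`).

## Already in the tree (cited, not restated)

Lemma 5.1 first half and its signed refinement (`AxisymNoSwirlCoSignedFlux`); the maximum
principle and sign persistence for `ω_θ/r` (`AxisymNoSwirlQuotMaxPrinciple`; KNSS 2009 §5);
global regularity of swirl-free axisymmetric flows (`axisymmetric_no_swirl_global_regularity_holds`,
Ladyzhenskaya / Ukhovskii–Yudovich); the Liouville and no-Type-I theorems of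
Koch–Nadirashvili–Seregin–Šverák 2009 (`KNSS2009_liouville_*_holds`,
`knss_no_axisymmetric_typeI_holds`, barrier `AxisymmetricTypeIExclusion_holds`); the Biot–Savart
representation `biotSavart_curl_eq_self_holds` (Majda–Bertozzi Prop. 2.16).

What is NOT here: the strict decrease in Lemma 5.1 (Hopf), Lemma 5.2 (Feng–Šverák's Nash-type
bound `‖η(t)‖_{L^p} ≤ Ct^{-3(1-1/p)/2}‖η₀‖_{L¹}`), Prop. 5.5, §3–§4 (semigroup, local
well-posedness, measures), §6.1 and Prop. 6.6; viscosities `ν ≠ 1` (Navier–Stokes scaling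
transports every statement; not done here).

## Mathlib / tree search

`lean search 'biotSavart|VelocitySup|impulse|Impulse|GallaySverak'`: `biotSavart`,
`biotSavart_curl_eq_self(_holds)` (`Vorticity`, `BiotSavartRepresentation`); no axisymmetric
Biot–Savart sup bound, no impulse conservation, no `t‖ω_θ‖_∞` / `√t‖u‖_∞` bound before this file.
Used: `curl_eq_hadamardQuotFst_smul_rotGen`, `angVortQuot_eq_hadamardQuotFst_curl`,
`curl_apply_two_eq_zero`, `inner_curl_horizontal_eq_zero` (`AxisymNoSwirlVorticity`,
`AxisymNoSwirlCoSignedFlux`), `IsAxisymmetric.curl` (`AxisymmetricVorticityTransport`),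
`IsTaoSolutionOn.exists_bound_fderiv_velocity`, `…integrable_norm_sq` (`TaoClassSliceData`),
`tendsto_cocompact_of_lipschitzWith_of_integrable_sq` (`LipschitzSqIntegrableDecay`),
`norm_curl_le` (`TaoEnstrophyLocalisation`), `IsTaoSolutionOn.isAxisymmetric`, `…hasNoSwirl`,
`…lintegral_abs_angVortQuot_le_of_datum`, `…angVortQuot_nonneg_of_datum`,
`…abs_angVortQuot_le_of_datum`, `…norm_curl_le_mul_cylRadius_of_datum`. Mathlib:
`lipschitzWith_of_nnnorm_fderiv_le`, `integral_norm_eq_lintegral_enorm`, `Integrable.mono'`.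

## References

* Th. Gallay, V. Šverák, *Remarks on the Cauchy problem for the axisymmetric Navier–Stokes
  equations*, Confluentes Math. 7 (2015) 67–92 = arXiv:1510.01036: Thm. 1.1 with (1.11)–(1.12)
  (p. 4), Prop. 2.6 (2.14)–(2.15) (p. 8), Remark 4.6 (p. 15), Lemma 5.1, Lemma 5.2, Prop. 5.3
  (5.7) (p. 16–17), (5.12) (p. 17), Lemma 6.4 (p. 19). [GallaySverak2016]
* H. Feng, V. Šverák, *On the Cauchy problem for axi-symmetric vortex rings*, Arch. Ration.
  Mech. Anal. 215 (2015) 89–123 = arXiv:1301.6317 (the original form of (2.14)).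
* G. Koch, N. Nadirashvili, G. Seregin, V. Šverák, Acta Math. 203 (2009) 83–105 =
  arXiv:0709.3599, §5 (the equation for `ω_θ/r`). [KochNadirashviliSereginSverak2009]
* A. J. Majda, A. L. Bertozzi, *Vorticity and Incompressible Flow*, CUP 2002, Prop. 2.16
  (Biot–Savart law). [MajdaBertozziCUP2002]
-/

noncomputable section

open MeasureTheory Set Function Filter Topology
open scoped RealInnerProductSpace ENNReal NNReal ContDiff

namespace Literature.Analysis.FluidPDE

/-! ### Dictionary: `‖ω‖ = r |ω_θ/r|` for axisymmetric swirl-free fields -/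

section Dictionary

variable {u : EuclideanSpace ℝ (Fin 3) → EuclideanSpace ℝ (Fin 3)}

/-- For an axisymmetric swirl-free `u ∈ C³` the vorticity is `ω = (ω_θ/r) · J x` with
`‖J x‖ = r`, hence `‖ω(x)‖ = r(x) · |(ω_θ/r)(x)|` everywhere — i.e. `|ω| = |ω_θ|` and
`ω_θ = r · angVortQuot u` (KNSS 2009, §5 p. 9: "for axi-symmetric flows without swirl we have
`ω_r = 0`, `ω_z = 0`"). [cite: KochNadirashviliSereginSverak2009, §5 p. 9 and Remark 5.1] -/
theorem norm_curl_eq_cylRadius_mul_abs_angVortQuot (hax : IsAxisymmetric u) (hsw : HasNoSwirl u)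
    (hu : ContDiff ℝ 3 u) (x : EuclideanSpace ℝ (Fin 3)) :
    ‖curl u x‖ = cylRadius x * |angVortQuot u x| := by
  have hu2 : ContDiff ℝ 2 u := hu.of_le (by norm_cast)
  rw [curl_eq_hadamardQuotFst_smul_rotGen hax hsw hu2 x,
    ← angVortQuot_eq_hadamardQuotFst_curl hax hsw hu, norm_smul, Real.norm_eq_abs, norm_rotGen,
    mul_comm]
  rfl

/-- The vorticity of an axisymmetric swirl-free `u ∈ C¹` is purely azimuthal: its radial part
`x₀ω₀ + x₁ω₁` and its axial part `ω₂` vanish (KNSS 2009, §5 p. 9; Gallay–Šverák (1.3):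
`ω = ω_θ e_θ`). [cite: GallaySverak2016, §1 (1.3) (arXiv p. 2)] -/
theorem curl_toroidal_of_hasNoSwirl (hax : IsAxisymmetric u) (hsw : HasNoSwirl u)
    (hu : ContDiff ℝ 1 u) (x : EuclideanSpace ℝ (Fin 3)) :
    x 0 * curl u x 0 + x 1 * curl u x 1 = 0 ∧ curl u x 2 = 0 :=
  ⟨inner_curl_horizontal_eq_zero hax hsw ((hu.differentiable (by simp)) x),
    curl_apply_two_eq_zero hax hsw hu x⟩

end Dictionary

/-! ### Cauchy–Schwarz: `‖rω_θ‖_{L¹(Ω)}² ≤ ‖ω_θ‖_{L¹(Ω)} · ‖r²ω_θ‖_{L¹(Ω)}` -/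

section CauchySchwarz

/-- `∫ r|η| ≤ (∫|η|)^{1/2} (∫r²|η|)^{1/2}` for `η, r²η ∈ L¹(ℝ³)` (`r = cylRadius`): the
Cauchy–Schwarz step `‖rω_θ‖_{L¹(Ω)} ≤ ‖ω_θ‖_{L¹(Ω)}^{1/2}‖r²ω_θ‖_{L¹(Ω)}^{1/2}` used to bound the
right-hand side of Gallay–Šverák's (2.14) by the two monotone quantities of Lemma 5.1 and
Lemma 6.4 (as in the proof of Prop. 6.6, arXiv p. 20: "`‖u‖_∞‖rω_θ‖_{L¹} ≤ … ≤
C‖ω_θ‖_{L¹}^{3/4}‖r²ω_θ‖_{L¹}^{3/4}‖ω_θ/r‖_∞^{1/2}`"). Proof: `r|η| ≤ (λ|η| + λ⁻¹r²|η|)/2` for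
every `λ > 0`, optimised. [cite: GallaySverak2016, proof of Prop. 6.6 (arXiv p. 20), the Cauchy–Schwarz step] -/
theorem integral_cylRadius_mul_le_sqrt {η : EuclideanSpace ℝ (Fin 3) → ℝ}
    (h1 : Integrable η) (h2 : Integrable fun x => cylRadius x ^ 2 * η x) :
    ∫ x, cylRadius x * |η x| ≤
      Real.sqrt (∫ x, |η x|) * Real.sqrt (∫ x, cylRadius x ^ 2 * |η x|) := by
  set A : ℝ := ∫ x, |η x| with hA
  set B : ℝ := ∫ x, cylRadius x ^ 2 * |η x| with hB
  have h1' : Integrable fun x => |η x| := h1.abs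
  have h2' : Integrable fun x => cylRadius x ^ 2 * |η x| := by
    have : (fun x => cylRadius x ^ 2 * |η x|) = fun x => |cylRadius x ^ 2 * η x| := by
      funext x; rw [abs_mul, abs_of_nonneg (sq_nonneg (cylRadius x))]
    rw [this]; exact h2.abs
  have hA0 : 0 ≤ A := integral_nonneg fun x => abs_nonneg _
  have hB0 : 0 ≤ B := integral_nonneg fun x => mul_nonneg (sq_nonneg _) (abs_nonneg _)
  -- the `λ`-inequality
  have key : ∀ l : ℝ, 0 < l → ∫ x, cylRadius x * |η x| ≤ (l * A + l⁻¹ * B) / 2 := by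
    intro l hl
    have hpt : ∀ x, cylRadius x * |η x| ≤ (l * |η x| + l⁻¹ * (cylRadius x ^ 2 * |η x|)) / 2 := by
      intro x
      have hη := abs_nonneg (η x)
      have hsq : 0 ≤ (l - cylRadius x) ^ 2 * |η x| := mul_nonneg (sq_nonneg _) hη
      have hl' : l⁻¹ * l = 1 := inv_mul_cancel₀ hl.ne'
      have : cylRadius x * |η x| * l ≤ (l * |η x| * l + cylRadius x ^ 2 * |η x|) / 2 := by
        nlinarith [hsq]
      calc cylRadius x * |η x| = cylRadius x * |η x| * l * l⁻¹ := by
            rw [mul_assoc, mul_inv_cancel₀ hl.ne', mul_one]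
        _ ≤ (l * |η x| * l + cylRadius x ^ 2 * |η x|) / 2 * l⁻¹ :=
            mul_le_mul_of_nonneg_right this (inv_nonneg.2 hl.le)
        _ = (l * |η x| + l⁻¹ * (cylRadius x ^ 2 * |η x|)) / 2 := by
            field_simp
    have hint : Integrable fun x => (l * |η x| + l⁻¹ * (cylRadius x ^ 2 * |η x|)) / 2 :=
      ((h1'.const_mul l).add (h2'.const_mul l⁻¹)).div_const 2
    calc ∫ x, cylRadius x * |η x| ≤ ∫ x, (l * |η x| + l⁻¹ * (cylRadius x ^ 2 * |η x|)) / 2 :=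
          integral_mono_of_nonneg (Eventually.of_forall fun x =>
            mul_nonneg (cylRadius_nonneg x) (abs_nonneg _)) hint (Eventually.of_forall hpt)
      _ = (l * A + l⁻¹ * B) / 2 := by
          rw [integral_div, integral_add (h1'.const_mul l) (h2'.const_mul l⁻¹), integral_const_mul,
            integral_const_mul]
  -- optimise over `λ`
  set c : ℝ := ∫ x, cylRadius x * |η x| with hc
  have hc0 : 0 ≤ c := integral_nonneg fun x => mul_nonneg (cylRadius_nonneg x) (abs_nonneg _)
  rcases hA0.eq_or_lt with hA' | hA'
  · -- `A = 0`: then `c ≤ B/(2λ)` for all `λ`, so `c = 0`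
    have hcz : c ≤ 0 := by
      by_contra hpos
      rw [not_le] at hpos
      rcases hB0.eq_or_lt with hB' | hB'
      · have := key 1 one_pos
        rw [← hA', ← hB'] at this
        linarith
      · have := key (B / c) (div_pos hB' hpos)
        rw [← hA'] at this
        have e : (B / c)⁻¹ * B = c := by field_simp
        rw [e] at this
        linarith
    have : c = 0 := le_antisymm hcz hc0
    rw [this]
    positivity
  rcases hB0.eq_or_lt with hB' | hB'
  · -- `B = 0`: then `c ≤ λA/2` for all `λ`, so `c = 0`
    have hcz : c ≤ 0 := by
      by_contra hpos
      rw [not_le] at hpos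
      have := key (c / A) (div_pos hpos hA')
      rw [← hB'] at this
      have e : c / A * A = c := by field_simp
      rw [e] at this
      linarith
    have : c = 0 := le_antisymm hcz hc0
    rw [this]
    positivity
  -- `A, B > 0`: take `λ = √B/√A`
  have hsA := Real.sqrt_pos.2 hA'
  have hsB := Real.sqrt_pos.2 hB'
  have := key (Real.sqrt B / Real.sqrt A) (div_pos hsB hsA)
  have hAA : Real.sqrt A * Real.sqrt A = A := Real.mul_self_sqrt hA0
  have hBB : Real.sqrt B * Real.sqrt B = B := Real.mul_self_sqrt hB0
  have eA : Real.sqrt B / Real.sqrt A * A = Real.sqrt A * Real.sqrt B := by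
    rw [div_mul_eq_mul_div, div_eq_iff hsA.ne']
    linear_combination (-Real.sqrt B) * hAA
  have eB : (Real.sqrt B / Real.sqrt A)⁻¹ * B = Real.sqrt A * Real.sqrt B := by
    rw [inv_div, div_mul_eq_mul_div, div_eq_iff hsB.ne']
    linear_combination (-Real.sqrt A) * hBB
  rw [eA, eB] at this
  linarith

end CauchySchwarz

/-! ### The named facts (Gallay–Šverák 2015) -/

namespace GallaySverak2015

/-- **Gallay–Šverák 2015, Proposition 2.6, estimate (2.14)** (the axisymmetric Biot–Savart bound
of Feng–Šverák): "`‖u‖_{L^∞(Ω)} ≤ C ‖r ω_θ‖_{L¹(Ω)}^{1/2} ‖ω_θ/r‖_{L^∞(Ω)}^{1/2}`", for the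
velocity field `u` defined from the azimuthal vorticity `ω_θ` by the axisymmetric Biot–Savart law
(2.8) (= the Biot–Savart law of `ℝ³` for `ω = ω_θ e_θ`), `Ω = {(r,z) : r > 0}` with the measure
`dr dz`. Rendering (see the module docstring): `ω : ℝ³ → ℝ³` continuous and integrable, purely
azimuthal and axisymmetric (`IsAxisymmetric ω`, `x₀ω₀ + x₁ω₁ = 0`, `ω₂ = 0`), with
`‖ω(x)‖ ≤ M · r(x)` (`‖ω_θ/r‖_∞ ≤ M`); then `‖(biotSavart ω)(x)‖ ≤ C √((∫‖ω‖ dx) · M)` for all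
`x`, where `∫_{ℝ³}‖ω‖ dx = 2π‖rω_θ‖_{L¹(Ω)}` and the factor `(2π)^{-1/2}` is absorbed into the
absolute constant `C`. [cite: GallaySverak2016, Prop. 2.6 (2.14) (arXiv p. 8)] -/
def VelocitySupBound : Prop :=
  ∃ C : ℝ, 0 ≤ C ∧
    ∀ (w : EuclideanSpace ℝ (Fin 3) → EuclideanSpace ℝ (Fin 3)) (M : ℝ),
      Continuous w → Integrable w → IsAxisymmetric w →
      (∀ x, x 0 * w x 0 + x 1 * w x 1 = 0) → (∀ x, w x 2 = 0) →
      (∀ x, ‖w x‖ ≤ M * cylRadius x) →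
      ∀ x, ‖biotSavart w x‖ ≤ C * Real.sqrt ((∫ y, ‖w y‖) * M)

/-- **Gallay–Šverák 2015, Lemma 6.4** (conservation of the impulse): "For any non-negative
solution of (4.1) in `L¹(Ω)` with finite impulse, we have
`∫_Ω r²ω_θ(r,z,t) dr dz = ∫_Ω r²ω₀(r,z) dr dz`, `t ≥ 0`" (the solutions being those of
Thm. 1.1 / §5, viscosity `1`; `𝓘 = ∫_Ω r²ω₀ dr dz`, (1.9)). Rendered for the tree's smooth class
(special case, see the module docstring): a Tao-class solution `(u, p)` on `[0, T]`, `0 < T`,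
`ν = 1`, from an axisymmetric swirl-free datum `u₀` with `η₀ = angVortQuot u₀ = ω_θ/r ≥ 0`,
`η₀ ∈ L¹(ℝ³)` (`ω₀ ∈ L¹(Ω)`) and `r²η₀ ∈ L¹(ℝ³)` (finite impulse,
`∫_{ℝ³} r²η dx = 2π ∫_Ω r²ω_θ dr dz`) keeps `r²η(t)` integrable with
`∫ r²η(t) dx = ∫ r²η₀ dx` for every `t ∈ [0, T]`. [cite: GallaySverak2016, Lemma 6.4 (arXiv p. 19)] -/
def ImpulseConservation : Prop :=
  ∀ ⦃T : ℝ⦄ ⦃u₀ : EuclideanSpace ℝ (Fin 3) → EuclideanSpace ℝ (Fin 3)⦄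
    ⦃u : ℝ → EuclideanSpace ℝ (Fin 3) → EuclideanSpace ℝ (Fin 3)⦄
    ⦃p : ℝ → EuclideanSpace ℝ (Fin 3) → ℝ⦄,
    0 < T → IsTaoSolutionOn T 1 u₀ u p → IsAxisymmetric u₀ → HasNoSwirl u₀ →
    (∀ x, 0 ≤ angVortQuot u₀ x) → Integrable (angVortQuot u₀) →
    Integrable (fun x => cylRadius x ^ 2 * angVortQuot u₀ x) →
    ∀ t ∈ Icc 0 T, Integrable (fun x => cylRadius x ^ 2 * angVortQuot (u t) x) ∧
      ∫ x, cylRadius x ^ 2 * angVortQuot (u t) x = ∫ x, cylRadius x ^ 2 * angVortQuot u₀ x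

/-- **Gallay–Šverák 2015, Proposition 5.3 with `p = ∞`** (= the scale-invariant a-priori estimate
(1.11) of Theorem 1.1): "Any solution `ω_θ ∈ C⁰([0,T],L¹(Ω)) ∩ C⁰((0,T],L^∞(Ω))` of (4.2) with
initial data `ω₀ ∈ L¹(Ω)` satisfies, for all `p ∈ [1,∞]`,
`‖ω_θ(t)‖_{L^p(Ω)} ≤ C_p(‖ω₀‖_{L¹(Ω)}) t^{-(1-1/p)}`, `0 < t ≤ T`, where `C_p(s) = O(s)` as
`s → 0`"; here `p = ∞`: `t ‖ω_θ(t)‖_{L^∞(Ω)} ≤ C_∞(‖ω₀‖_{L¹(Ω)})`. Rendered for the tree's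
smooth class (special case, see the module docstring): there is `C : ℝ → ℝ` with `C(s) ≤ K s` on
some `[0, δ]`, `δ > 0`, such that every Tao-class solution `(u, p)` on `[0, T]` (`0 < T`, `ν = 1`)
from an axisymmetric swirl-free datum `u₀` with `η₀ = angVortQuot u₀ ∈ L¹(ℝ³)` obeys
`t · ‖curl (u t) x‖ ≤ C(M)` for all `t ∈ (0, T]`, `x ∈ ℝ³`, where
`M = ‖ω₀‖_{L¹(Ω)} = (2π)⁻¹ ∫ |η₀| dx` and `‖curl (u t) x‖ = |ω_θ(t, x)|` (no swirl).
[cite: GallaySverak2016, Prop. 5.3 (5.7) with p = ∞ and (1.11) (arXiv pp. 4, 16–17)] -/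
def VorticitySupBound : Prop :=
  ∃ C : ℝ → ℝ, (∃ K δ : ℝ, 0 < δ ∧ ∀ s, 0 ≤ s → s ≤ δ → C s ≤ K * s) ∧
    ∀ ⦃T : ℝ⦄ ⦃u₀ : EuclideanSpace ℝ (Fin 3) → EuclideanSpace ℝ (Fin 3)⦄
      ⦃u : ℝ → EuclideanSpace ℝ (Fin 3) → EuclideanSpace ℝ (Fin 3)⦄
      ⦃p : ℝ → EuclideanSpace ℝ (Fin 3) → ℝ⦄,
      0 < T → IsTaoSolutionOn T 1 u₀ u p → IsAxisymmetric u₀ → HasNoSwirl u₀ →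
      Integrable (angVortQuot u₀) →
      ∀ t ∈ Ioc 0 T, ∀ x, t * ‖curl (u t) x‖ ≤ C ((2 * Real.pi)⁻¹ * ∫ y, |angVortQuot u₀ y|)

/-- **Gallay–Šverák 2015, (1.12)** (= (5.12) in the proof of Prop. 5.5): "Using the axisymmetric
Biot–Savart law, we also deduce the following optimal bound on the velocity field
`sup_{t>0} t^{1/2}‖u(t)‖_{L^∞(Ω)} ≤ C(‖ω₀‖_{L¹(Ω)})`", `C(s) = O(s)` as `s → 0`, for the solutions
of Thm. 1.1 (viscosity `1`; (5.12): `‖u(t₀)‖_∞ ≤ C‖ω_θ(t₀)‖_{L¹(Ω)}^{1/2}‖ω_θ(t₀)‖_∞^{1/2} ≤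
C(M)/√t₀`). Rendered for the tree's smooth class (special case, see the module docstring): there
is `C : ℝ → ℝ` with `C(s) ≤ K s` on some `[0, δ]`, `δ > 0`, such that every Tao-class solution
`(u, p)` on `[0, T]` (`0 < T`, `ν = 1`) from an axisymmetric swirl-free datum `u₀` with
`η₀ = angVortQuot u₀ ∈ L¹(ℝ³)` obeys `√t · ‖u t x‖ ≤ C(M)` for all `t ∈ (0, T]`, `x ∈ ℝ³`,
`M = ‖ω₀‖_{L¹(Ω)} = (2π)⁻¹ ∫ |η₀| dx`. [cite: GallaySverak2016, Thm. 1.1 discussion (1.12) (arXiv p. 4) and (5.12) (p. 17)] -/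
def VelocitySupDecay : Prop :=
  ∃ C : ℝ → ℝ, (∃ K δ : ℝ, 0 < δ ∧ ∀ s, 0 ≤ s → s ≤ δ → C s ≤ K * s) ∧
    ∀ ⦃T : ℝ⦄ ⦃u₀ : EuclideanSpace ℝ (Fin 3) → EuclideanSpace ℝ (Fin 3)⦄
      ⦃u : ℝ → EuclideanSpace ℝ (Fin 3) → EuclideanSpace ℝ (Fin 3)⦄
      ⦃p : ℝ → EuclideanSpace ℝ (Fin 3) → ℝ⦄,
      0 < T → IsTaoSolutionOn T 1 u₀ u p → IsAxisymmetric u₀ → HasNoSwirl u₀ →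
      Integrable (angVortQuot u₀) →
      ∀ t ∈ Ioc 0 T, ∀ x, Real.sqrt t * ‖u t x‖ ≤ C ((2 * Real.pi)⁻¹ * ∫ y, |angVortQuot u₀ y|)

end GallaySverak2015

/-! ### Unpacked forms of the dynamic facts -/

section Unpack

variable {T : ℝ} {u₀ : EuclideanSpace ℝ (Fin 3) → EuclideanSpace ℝ (Fin 3)}
  {u : ℝ → EuclideanSpace ℝ (Fin 3) → EuclideanSpace ℝ (Fin 3)}
  {p : ℝ → EuclideanSpace ℝ (Fin 3) → ℝ}

/-- **Gallay–Šverák (1.11) unpacked**: from the fact `VorticitySupBound`, along a Tao-class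
solution (`ν = 1`) from an axisymmetric swirl-free datum with `ω₀ ∈ L¹(Ω)`, the vorticity obeys
`‖ω(t, x)‖ ≤ C(‖ω₀‖_{L¹(Ω)}) / t` for `0 < t ≤ T` — no blow-up of `‖ω_θ‖_∞` at any finite time,
with a scale-invariant rate. [cite: GallaySverak2016, Prop. 5.3 (5.7) p = ∞ (arXiv p. 16)] -/
theorem IsTaoSolutionOn.norm_curl_le_of_fact (hF : GallaySverak2015.VorticitySupBound)
    (h : IsTaoSolutionOn T 1 u₀ u p) (hT : 0 < T) (h0 : IsAxisymmetric u₀) (h0' : HasNoSwirl u₀)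
    (hL1 : Integrable (angVortQuot u₀)) :
    ∃ C : ℝ → ℝ, (∃ K δ : ℝ, 0 < δ ∧ ∀ s, 0 ≤ s → s ≤ δ → C s ≤ K * s) ∧
      ∀ t ∈ Ioc 0 T, ∀ x,
        ‖curl (u t) x‖ ≤ C ((2 * Real.pi)⁻¹ * ∫ y, |angVortQuot u₀ y|) / t := by
  obtain ⟨C, hC, hF⟩ := hF
  refine ⟨C, hC, fun t ht x => ?_⟩
  rw [le_div_iff₀ ht.1, mul_comm]
  exact hF hT h h0 h0' hL1 t ht x

/-- **Gallay–Šverák (1.12) unpacked**: from the fact `VelocitySupDecay`, along a Tao-class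
solution (`ν = 1`) from an axisymmetric swirl-free datum with `ω₀ ∈ L¹(Ω)`, the speed obeys
`‖u(t, x)‖ ≤ C(‖ω₀‖_{L¹(Ω)}) / √t` for `0 < t ≤ T`; in particular
`sup_{t ≥ t₁} ‖u(t)‖_∞ ≤ C(‖ω₀‖_{L¹(Ω)})/√t₁` for every `t₁ > 0` — an all-time speed bound after
any positive delay, for every swirl-free axisymmetric flow with `ω₀ ∈ L¹(Ω)` (no sign or impulse
condition). [cite: GallaySverak2016, (1.12) (arXiv p. 4) and (5.12) (p. 17)] -/
theorem IsTaoSolutionOn.norm_le_div_sqrt_of_fact (hF : GallaySverak2015.VelocitySupDecay)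
    (h : IsTaoSolutionOn T 1 u₀ u p) (hT : 0 < T) (h0 : IsAxisymmetric u₀) (h0' : HasNoSwirl u₀)
    (hL1 : Integrable (angVortQuot u₀)) :
    ∃ C : ℝ → ℝ, (∃ K δ : ℝ, 0 < δ ∧ ∀ s, 0 ≤ s → s ≤ δ → C s ≤ K * s) ∧
      ∀ t ∈ Ioc 0 T, ∀ x,
        ‖u t x‖ ≤ C ((2 * Real.pi)⁻¹ * ∫ y, |angVortQuot u₀ y|) / Real.sqrt t := by
  obtain ⟨C, hC, hF⟩ := hF
  refine ⟨C, hC, fun t ht x => ?_⟩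
  rw [le_div_iff₀ (Real.sqrt_pos.2 ht.1), mul_comm]
  exact hF hT h h0 h0' hL1 t ht x

end Unpack

/-! ### A Tao-class slice is the Biot–Savart velocity of its vorticity -/

section Slice

variable {T ν : ℝ} {u₀ : EuclideanSpace ℝ (Fin 3) → EuclideanSpace ℝ (Fin 3)}
  {u : ℝ → EuclideanSpace ℝ (Fin 3) → EuclideanSpace ℝ (Fin 3)}
  {p : ℝ → EuclideanSpace ℝ (Fin 3) → ℝ}

/-- The velocity slices of a Tao-class solution tend to `0` at spatial infinity (they are
Lipschitz, `‖Du‖ ≤ B'`, and square integrable). [folklore] -/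
private theorem IsTaoSolutionOn.tendsto_velocity_cocompact (h : IsTaoSolutionOn T ν u₀ u p) {t : ℝ}
    (ht : t ∈ Icc 0 T) :
    Tendsto (u t) (cocompact (EuclideanSpace ℝ (Fin 3))) (𝓝 0) := by
  obtain ⟨B', hB'0, hB'⟩ := h.exists_bound_fderiv_velocity
  have hd : Differentiable ℝ (u t) := (h.classical.contDiff_velocity ht).differentiable (by simp)
  have hL : LipschitzWith ⟨B', hB'0⟩ (u t) :=
    lipschitzWith_of_nnnorm_fderiv_le hd fun x => by
      rw [← NNReal.coe_le_coe, coe_nnnorm]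
      exact hB' t ht x
  exact tendsto_cocompact_of_lipschitzWith_of_integrable_sq hL (h.integrable_norm_sq ht)

/-- The vorticity of a Tao-class solution is bounded on the slab (`‖curl v‖ ≤ ‖curlCLM‖‖Dv‖`).
[folklore] -/
private theorem IsTaoSolutionOn.exists_bound_curl (h : IsTaoSolutionOn T ν u₀ u p) :
    ∃ B : ℝ, ∀ t ∈ Icc 0 T, ∀ x, ‖curl (u t) x‖ ≤ B := by
  obtain ⟨B', -, hB'⟩ := h.exists_bound_fderiv_velocity
  refine ⟨‖(curlCLM : (EuclideanSpace ℝ (Fin 3) →L[ℝ] EuclideanSpace ℝ (Fin 3)) →L[ℝ]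
      EuclideanSpace ℝ (Fin 3))‖ * B', fun t ht x => (norm_curl_le (u t) x).trans ?_⟩
  exact mul_le_mul_of_nonneg_left (hB' t ht x) (by positivity)

/-- **A Tao-class slice with integrable vorticity is the Biot–Savart velocity of its vorticity**,
`u(t) = K₃ * ω(t)`: the tree's Biot–Savart representation theorem `biotSavart_curl_eq_self_holds`
(Majda–Bertozzi Prop. 2.16) applies, the slice being `C¹`, divergence free, vanishing at infinity,
with bounded vorticity. (This identifies the paper's "velocity field defined from `ω_θ` via the
axisymmetric Biot–Savart law" with the velocity of a smooth finite-energy solution.)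
[cite: MajdaBertozziCUP2002, §2.4.1 Prop. 2.16] -/
theorem IsTaoSolutionOn.biotSavart_curl_eq (h : IsTaoSolutionOn T ν u₀ u p) {t : ℝ}
    (ht : t ∈ Icc 0 T) (hint : Integrable (curl (u t))) : biotSavart (curl (u t)) = u t := by
  obtain ⟨B, hB⟩ := h.exists_bound_curl
  exact biotSavart_curl_eq_self_holds (u t)
    ((h.classical.contDiff_velocity ht).of_le (by exact_mod_cast le_top))
    (h.classical.divFree t ht) (h.tendsto_velocity_cocompact ht) hint ⟨B, hB t ht⟩

end Slice

/-! ### The all-time speed cap for single-signed swirl-free flows with finite impulse -/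

section SpeedCap

/-- **All-time speed cap** (assembled from Gallay–Šverák 2015, Prop. 2.6 (2.14), Lemma 5.1,
Lemma 6.4, and the maximum principle for `ω_θ/r`). Assume the named facts `VelocitySupBound`
(Prop. 2.6) and `ImpulseConservation` (Lemma 6.4), and let `C` be the constant of Prop. 2.6. Let
`(u, p)` be a Tao-class solution on `[0, T]` (`0 < T`, `ν = 1`) of the unforced Navier–Stokes
system from an axisymmetric swirl-free datum `u₀` whose `η₀ = ω_θ/r = angVortQuot u₀` satisfies
`0 ≤ η₀ ≤ M`, `η₀ ∈ L¹(ℝ³)` and `r²η₀ ∈ L¹(ℝ³)`. Then for every `t ∈ [0, T]` and `x ∈ ℝ³`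

  `‖u(t, x)‖ ≤ C · √( √((∫η₀ dx)(∫r²η₀ dx)) · M ) = C (∫η₀)^{1/4} (∫r²η₀)^{1/4} M^{1/2}`,

a bound fixed by the datum and uniform in time (in the paper's units
`C' ‖ω_θ(0)‖_{L¹(Ω)}^{1/4} 𝓘^{1/4} ‖ω_θ(0)/r‖_{L^∞}^{1/2}`). Proof: at time `t` the slice is
axisymmetric without swirl with `0 ≤ η(t) ≤ M` (sign persistence and maximum principle,
`AxisymNoSwirlQuotMaxPrinciple`), `∫η(t) ≤ ∫η₀` (Lemma 5.1, `AxisymNoSwirlCoSignedFlux`),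
`∫r²η(t) = ∫r²η₀` (Lemma 6.4); hence `ω(t) = curl u(t)`, `‖ω(t)‖ = rη(t) ≤ (η(t) + r²η(t))/2`, is
integrable with `∫‖ω(t)‖ ≤ (∫η(t))^{1/2}(∫r²η(t))^{1/2} ≤ (∫η₀)^{1/2}(∫r²η₀)^{1/2}`
(Cauchy–Schwarz), `u(t) = biotSavart ω(t)` (`IsTaoSolutionOn.biotSavart_curl_eq`), and (2.14)
gives `‖u(t,x)‖ ≤ C√((∫‖ω(t)‖) M)`. [cite: GallaySverak2016, Prop. 2.6 (2.14), Lemma 5.1, Lemma 6.4 (arXiv pp. 8, 16, 19)] -/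
theorem speedCap_of_facts (hBS : GallaySverak2015.VelocitySupBound)
    (hI : GallaySverak2015.ImpulseConservation) :
    ∃ C : ℝ, 0 ≤ C ∧
      ∀ ⦃T : ℝ⦄ ⦃u₀ : EuclideanSpace ℝ (Fin 3) → EuclideanSpace ℝ (Fin 3)⦄
        ⦃u : ℝ → EuclideanSpace ℝ (Fin 3) → EuclideanSpace ℝ (Fin 3)⦄
        ⦃p : ℝ → EuclideanSpace ℝ (Fin 3) → ℝ⦄ ⦃M : ℝ⦄,
        0 < T → IsTaoSolutionOn T 1 u₀ u p → IsAxisymmetric u₀ → HasNoSwirl u₀ →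
        (∀ x, 0 ≤ angVortQuot u₀ x) → (∀ x, angVortQuot u₀ x ≤ M) →
        Integrable (angVortQuot u₀) → Integrable (fun x => cylRadius x ^ 2 * angVortQuot u₀ x) →
        ∀ t ∈ Icc 0 T, ∀ x,
          ‖u t x‖ ≤ C * Real.sqrt (Real.sqrt ((∫ y, angVortQuot u₀ y) *
            ∫ y, cylRadius y ^ 2 * angVortQuot u₀ y) * M) := by
  obtain ⟨C, hC0, hBS⟩ := hBS
  refine ⟨C, hC0, fun T u₀ u p M hT h h0 h0' hη0 hηM hL1 hImp t ht x => ?_⟩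
  have h0T : (0 : ℝ) ∈ Icc 0 T := ⟨le_rfl, hT.le⟩
  have hM0 : 0 ≤ M := (hη0 0).trans (hηM 0)
  -- the slice at time `t`
  have hax : IsAxisymmetric (u t) := h.isAxisymmetric one_pos hT h0 t ht
  have hsw : HasNoSwirl (u t) := h.hasNoSwirl one_pos hT h0 h0' t ht
  have hu3 : ContDiff ℝ 3 (u t) := (h.classical.contDiff_velocity ht).of_le (by norm_cast)
  have hu1 : ContDiff ℝ 1 (u t) := hu3.of_le (by norm_cast)
  have hηc : Continuous (angVortQuot (u t)) :=
    (contDiff_angVortQuot (n := 0) (by exact_mod_cast hu3)).continuous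
  have habs0 : ∀ y, |angVortQuot u₀ y| ≤ M := fun y => by
    rw [abs_of_nonneg (hη0 y)]; exact hηM y
  have hηt0 : ∀ y, 0 ≤ angVortQuot (u t) y := fun y =>
    h.angVortQuot_nonneg_of_datum hT one_pos h0 h0' hη0 ht y
  have hωr : ∀ y, ‖curl (u t) y‖ ≤ M * cylRadius y := fun y =>
    h.norm_curl_le_mul_cylRadius_of_datum hT one_pos h0 h0' habs0 ht y
  have hωeq : ∀ y, ‖curl (u t) y‖ = cylRadius y * |angVortQuot (u t) y| :=
    norm_curl_eq_cylRadius_mul_abs_angVortQuot hax hsw hu3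
  -- `η(t) ∈ L¹` with `∫|η(t)| ≤ ∫|η₀|` (Lemma 5.1, tree)
  have hlin : ∫⁻ y, ‖angVortQuot (u t) y‖ₑ ≤ ∫⁻ y, ‖angVortQuot u₀ y‖ₑ := by
    have := h.lintegral_abs_angVortQuot_le_of_datum hT one_pos h0 h0' h0T ht ht.1
    rwa [h.initial] at this
  have hηint : Integrable (angVortQuot (u t)) :=
    ⟨hηc.aestronglyMeasurable, lt_of_le_of_lt hlin hL1.hasFiniteIntegral⟩
  have hA : ∫ y, |angVortQuot (u t) y| ≤ ∫ y, angVortQuot u₀ y := by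
    have e1 : ∫ y, |angVortQuot (u t) y| = (∫⁻ y, ‖angVortQuot (u t) y‖ₑ).toReal := by
      rw [← integral_norm_eq_lintegral_enorm hηc.aestronglyMeasurable]
      simp only [Real.norm_eq_abs]
    have e2 : ∫ y, angVortQuot u₀ y = (∫⁻ y, ‖angVortQuot u₀ y‖ₑ).toReal := by
      rw [← integral_norm_eq_lintegral_enorm hL1.aestronglyMeasurable]
      exact integral_congr_ae (Eventually.of_forall fun y => by
        simp only [Real.norm_eq_abs, abs_of_nonneg (hη0 y)])
    rw [e1, e2]
    exact ENNReal.toReal_mono hL1.hasFiniteIntegral.ne hlin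
  -- the impulse at time `t` (Lemma 6.4)
  obtain ⟨hIt, hIeq⟩ := hI hT h h0 h0' hη0 hL1 hImp t ht
  have hB : ∫ y, cylRadius y ^ 2 * |angVortQuot (u t) y| =
      ∫ y, cylRadius y ^ 2 * angVortQuot u₀ y := by
    rw [← hIeq]
    exact integral_congr_ae (Eventually.of_forall fun y => by
      simp only [abs_of_nonneg (hηt0 y)])
  -- `ω(t) ∈ L¹` with `∫‖ω(t)‖ ≤ √(∫η₀) √(∫r²η₀)`
  have hωc : Continuous (curl (u t)) := continuous_curl hu1
  have hωint : Integrable (curl (u t)) := by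
    refine Integrable.mono' ((hηint.abs.add hIt).div_const 2) hωc.aestronglyMeasurable
      (Eventually.of_forall fun y => ?_)
    show ‖curl (u t) y‖ ≤ (|angVortQuot (u t) y| + cylRadius y ^ 2 * angVortQuot (u t) y) / 2
    rw [hωeq y]
    have e : cylRadius y ^ 2 * angVortQuot (u t) y = cylRadius y ^ 2 * |angVortQuot (u t) y| := by
      rw [abs_of_nonneg (hηt0 y)]
    rw [e]
    nlinarith [mul_nonneg (sq_nonneg (cylRadius y - 1)) (abs_nonneg (angVortQuot (u t) y))]
  have hAω : ∫ y, ‖curl (u t) y‖ ≤ Real.sqrt ((∫ y, angVortQuot u₀ y) *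
      ∫ y, cylRadius y ^ 2 * angVortQuot u₀ y) := by
    have hIt' : Integrable fun y => cylRadius y ^ 2 * angVortQuot (u t) y := hIt
    calc ∫ y, ‖curl (u t) y‖ = ∫ y, cylRadius y * |angVortQuot (u t) y| := integral_congr_ae
          (Eventually.of_forall fun y => hωeq y)
      _ ≤ Real.sqrt (∫ y, |angVortQuot (u t) y|) *
            Real.sqrt (∫ y, cylRadius y ^ 2 * |angVortQuot (u t) y|) :=
          integral_cylRadius_mul_le_sqrt hηint hIt'
      _ ≤ Real.sqrt (∫ y, angVortQuot u₀ y) *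
            Real.sqrt (∫ y, cylRadius y ^ 2 * angVortQuot u₀ y) := by
          rw [hB]
          exact mul_le_mul_of_nonneg_right (Real.sqrt_le_sqrt hA) (Real.sqrt_nonneg _)
      _ = Real.sqrt ((∫ y, angVortQuot u₀ y) * ∫ y, cylRadius y ^ 2 * angVortQuot u₀ y) := by
          rw [Real.sqrt_mul (integral_nonneg fun y => hη0 y)]
  -- Prop. 2.6 for `ω(t)`, and `u(t) = biotSavart ω(t)`
  have hBSt := hBS (curl (u t)) M hωc hωint (hax.curl (hu1.differentiable (by simp)))
    (fun y => (curl_toroidal_of_hasNoSwirl hax hsw hu1 y).1)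
    (fun y => (curl_toroidal_of_hasNoSwirl hax hsw hu1 y).2) hωr x
  rw [h.biotSavart_curl_eq ht hωint] at hBSt
  refine hBSt.trans (mul_le_mul_of_nonneg_left (Real.sqrt_le_sqrt ?_) hC0)
  exact mul_le_mul_of_nonneg_right hAω hM0

end SpeedCap

end Literature.Analysis.FluidPDE

end
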